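import Summits.QuantumFields.BalabanUV.Beta.GAN24.Lin4SlotDivergence

/-!
# `BalabanUV.Beta.GAN24.E3SlotDivergence` — binder row G-an2-4 ∕ (CONV-C), CT-W: THE SLOT DIVERGENCE OF THE S-SLOT MAP `e3OfK` IS THE
# RESOLVENT SANDWICH OF THE BLOCK-SUMMED FINE DIVERGENCE, AND THE DOUBLE SOURCE-SLOT DIVERGENCE OF THE LINEAR STEP `lin4`
# («T-EQ» one storey up: WARD3-GAN24 §3 (3.2) «|S| = 1 → |S| = 2, source slots»; sequel of `GAN24/Lin4SlotDivergence`; G-an2-4 formalisation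
# swarm, leaf prover `b2b-balaban-gan24-formalise-leaf-03`, gen 58; module name PROVISIONAL — the row owner gan24-p1 may rename ∕ re-home it)

NOT IN PRINT; OUR BOOKKEEPING.  HONEST FRAMING (cell contract, verbatim): «discharging `BetaPertH` makes Bałaban's UV stability
UNCONDITIONAL — a real constructive-QFT result; it is NOT the continuum limit and NOT the Clay problem.»  HONEST DEPENDENCY (verbatim):
«continuum YM on T⁴ ⇐ BetaPertH ∧ nine spine estimates (0/9 proved); BetaPertH ⇐ (D1) ∧ (D4) ∧ CAP+tail; G-an2-4 gates asym, D1 and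
NE2/3/4.»

WHAT ([folklore] kernel algebra BY NAME over `GAN24/Lin4SlotDivergence`, d1-leaf-10's `WardLocusSecondOrder.divV_vertexOfK_of_bdd`, an1's
`KernelWardRelative.wsum_gaugeWt` ∕ `WardLocusCubic.e3K`, an5's `ValueJetGeneric.e3OfK`, leaf-01's `Lin4Additive` bounded-table calculus; for ANY
decaying packed kernel `K` (rate `δ > 0`), blocking `N ≥ 1`, bounded families, UNDER the ℋ-column Ward law (hH) with constant `c_H` — a HYPOTHESIS of
§1–§3, DISCHARGED for the comb ∕ wall instance in §4; 0 `def`, 0 cite, 0 `def … : Prop`, 0 sorry):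
* §1 **`divV_vertexOfK_eq_smul_boxSum`** — the HOMOGENEOUS block form of an1's `divV_vertexOfK_eq_conjV` (no stencil law):
  `divV (vertexOfK K N S) y = c_H • Σ_{v ∈ box (d+1) N} divV S (N•y + toSite v)` for a BOUNDED stencil family `S`; `e3K_eq_e3OfK` (an1's and an5's
  names of the S-slot map agree, `rfl`); `divV_smul_family`.
* §2 **`divV_e3OfK`**: `divV (e3OfK N K S) y = −(c_H • mmRead N (K ∘ (Σ_{v ∈ box} divV S (N•y + toSite v)) ∘ K))` — the coarse pure-gauge vertex of
  the S-slot map (the linear part of an2's `SpureRecAt` recursion, an1's cubic jet `e3K`) is `−c_H ×` the RESOLVENT SANDWICH (the K-slot map, no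
  chain-rule vertex left) of the block-summed FINE pure-gauge vertex of the family: WARD3's storey map `𝒜^{(S)}` for `|S| = 2` source slots, resp.
  the homogeneous part of an1's `WardLocusCubic.divV_e3K_eq_conjV` (there composed with the stencil's block law (hSd) and the relative rules).
* §3 **`divV_divW_lin4_of_symm`**: for a `(κ,u) ↔ (κ′,u′)`-symmetric bounded bi-table `T`, the DOUBLE source-slot divergence of the linear step,
  `divV (ν y′ ↦ divW (lin4 c K N T) y ν y′) y′ = −((c·c_H·c_H) • mmRead N (K ∘ (Σ_{v′ ∈ box} divV F_y (N•y′ + toSite v′)) ∘ K))`,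
  `F_y := κ u ↦ Σ_{v ∈ box} divV (T κ u) (N•y + toSite v)` the block-summed fine slice of PART 1 — both source slots divergenced: both chain-rule
  vertices are gone, the two coarse sites `y, y′` are passive block labels of a doubly block-summed double fine divergence, sandwiched by `K`.
* §4 THE COMB ∕ WALL INSTANCE (`K♮ᴱ_j := unitK (sfStep Lc j) (smStep d Lc j) (coDressKBmAt (toSite r) Lc (KInvStep Lc j))`, `N := Lc`, `c_H = (Lc^{d+1})⁻¹`
  `j`-free by PART 1's `hH_unitK_comb`): **`divV_e3OfK_comb`**, **`divV_divW_lin4_comb_of_symm`**.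

Asserts NO shape or rate of Bałaban's tables; decides nothing about RULING R-gan24p1-g23-3 (iii) ∕ the OWNER g24's CT-W-DESIGN-v2 by itself;
discharges NOTHING of «T2Shape» ∕ «T2Drift» ∕ (hW, hWall) ∕ (C); 0 wall binders; NEVER «G-an2-4 closed» as (CONV-C); NOT D1, NOT `BetaPertH`, NOT
continuum, NOT Clay; not in print — our bookkeeping.  Unit `b2b-balaban-gan24-formalise-leaf-03` (gen 58), 2026-08-22.
-/

noncomputable section

open Finset
open scoped BigOperators
open Literature.MathematicalPhysics.QuantumFieldTheory
open Literature.MathematicalPhysics.QuantumFieldTheory.Balaban1983to89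
open Literature.MathematicalPhysics.QuantumFieldTheory.Balaban1983to89.Beta
open B6BondElimination (unitVec)
open ExpKernelCalculus (MKer Decays comp)
open OneStepResolventKernel (Fib wsum)
open OneStepKernelFamily (colH vertexOfK KInvStep)
open BalabanStepJetsSucc (mmRead)
open KernelWard (divV divW Bdd)
open AffineAveraging (box toSite)
open Summit.QuantumFields.BalabanUV.Beta.KernelWardRelative (gaugeWt wsum_gaugeWt)
open Summit.QuantumFields.BalabanUV.Beta.WardLocusSecondOrder (divV_vertexOfK_of_bdd)
open Summit.QuantumFields.BalabanUV.Beta.WardLocusCubic (e3K)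
open Summit.QuantumFields.BalabanUV.Beta.GAN24.ThirdJetKernel (mmRead_smul)
open Summit.QuantumFields.BalabanUV.Beta.GAN24.T2RecursionAffine (lin4)
open Summit.QuantumFields.BalabanUV.Beta.GAN24.Lin4Additive (abs_vertexOfK_le)
open Summit.QuantumFields.BalabanUV.Beta.SpineRooted (e3OfK e3OfK_apply)
open Summit.QuantumFields.BalabanUV.Beta.HessKerDressedUnits (unitK decays_unitK)
open Summit.QuantumFields.BalabanUV.Beta.GAN24.CombesThomas (sfStep smStep)
open Summit.QuantumFields.BalabanUV.Beta.AxialDressingRooted (coDressKBmAt one_le_of_neZero decays_coDressKBmAt_KInvStep)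
open Summit.QuantumFields.BalabanUV.Beta.GAN24.Lin4SlotDivergence (abs_boxSum_divV_le sandwich_sub sandwich_finset_sum e3OfK_eq_neg_sandwich
  divW_lin4_of_symm hH_unitK_comb)

namespace Summit.QuantumFields.BalabanUV.Beta.GAN24.E3SlotDivergence

variable {d N : ℕ}

/-! ## §1 The homogeneous block form of the vertex divergence; names; linearity of `divV` -/

/-- [folklore] **THE COARSE DIVERGENCE OF A DRESSED VERTEX SLOT IS `c_H` × THE BLOCK SUM OF THE FINE DIVERGENCE** (the homogeneous form of
an1's `KernelWardRelative.divV_vertexOfK_eq_conjV`, no stencil law; d1-leaf-10's `divV_vertexOfK_of_bdd` + an1's `wsum_gaugeWt`): for a decaying `K`,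
`N ≥ 1`, a BOUNDED stencil family `S` and (hH) with constant `c_H`, `divV (vertexOfK K N S) y = c_H • Σ_{v ∈ box (d+1) N} divV S (N•y + toSite v)`. -/
theorem divV_vertexOfK_eq_smul_boxSum {K : MKer (d + 1) (Fib d)} (hK : ∃ δ C : ℝ, 0 < δ ∧ 0 ≤ C ∧ Decays K C δ) (hN : 1 ≤ N)
    {S : Fin (d + 1) → (Fin (d + 1) → ℤ) → MKer (d + 1) (Fib d)} {B : ℝ} (hS : ∀ κ' u x z a b, |S κ' u x z a b| ≤ B) (cH : ℝ)
    (hH : ∀ (y : Fin (d + 1) → ℤ) (κ' : Fin (d + 1)) (u : Fin (d + 1) → ℤ),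
      ∑ μ, (colH K N μ (y - unitVec μ) κ' u - colH K N μ y κ' u) = cH * gaugeWt N y κ' u)
    (y : Fin (d + 1) → ℤ) :
    divV (vertexOfK K N S) y = cH • ∑ v ∈ box (d + 1) N, divV S ((N : ℤ) • y + toSite v) := by
  rw [divV_vertexOfK_of_bdd (N := N) hK hS y]
  have e : ∀ κ' : Fin (d + 1), wsum (fun u => ∑ μ, (colH K N μ (y - unitVec μ) κ' u - colH K N μ y κ' u)) (S κ')
      = cH • ∑ v ∈ box (d + 1) N, (S κ' ((N : ℤ) • y + toSite v - unitVec κ') - S κ' ((N : ℤ) • y + toSite v)) := by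
    intro κ'
    rw [← wsum_gaugeWt hN cH y κ' (S κ')]
    congr 1
    funext u
    exact hH y κ' u
  simp only [e, ← Finset.smul_sum]
  congr 1
  rw [Finset.sum_comm]
  refine Finset.sum_congr rfl fun v _ => ?_
  simp only [KernelWard.divV]

/-- [folklore] an1's cubic jet `WardLocusCubic.e3K K N S` and an5's S-slot map `ValueJetGeneric.e3OfK N K S` are the same family. -/
theorem e3K_eq_e3OfK (K : MKer (d + 1) (Fib d)) (N : ℕ) (S : Fin (d + 1) → (Fin (d + 1) → ℤ) → MKer (d + 1) (Fib d)) :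
    e3K K N S = e3OfK N K S := by
  funext κ' u'
  rw [e3OfK_eq_neg_sandwich]
  rfl

/-- [folklore] The coarse pure-gauge vertex is homogeneous in its family: `divV (c • V) y = c • divV V y`. -/
theorem divV_smul_family (c : ℝ) (V : Fin (d + 1) → (Fin (d + 1) → ℤ) → MKer (d + 1) (Fib d)) (y : Fin (d + 1) → ℤ) :
    divV (c • V) y = c • divV V y := by
  simp only [KernelWard.divV, Pi.smul_apply, Finset.smul_sum, smul_sub]

/-! ## §2 The slot divergence of the S-slot map is the resolvent sandwich of the block-summed fine divergence -/

section SSlot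

variable {K : MKer (d + 1) (Fib d)} {C δ : ℝ} {S : Fin (d + 1) → (Fin (d + 1) → ℤ) → MKer (d + 1) (Fib d)} {B : ℝ} {cH : ℝ}

/-- [folklore] **T-EQ FOR THE S-SLOT MAP**: for a decaying `K` (rate `δ > 0`), `N ≥ 1`, a bounded stencil family `S` and (hH) with constant `c_H`,
`divV (e3OfK N K S) y = −(c_H • mmRead N (K ∘ (Σ_{v ∈ box (d+1) N} divV S (N•y + toSite v)) ∘ K))` — the chain-rule vertex of the slot is gone; what
remains is the RESOLVENT SANDWICH of the block-summed fine pure-gauge vertex, read on the multiplier block (the K-slot map; `y` a passive label). -/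
theorem divV_e3OfK (hK : Decays K C δ) (hδ : 0 < δ) (hN : 1 ≤ N) (hS : ∀ κ u x z a b, |S κ u x z a b| ≤ B)
    (hH : ∀ (y : Fin (d + 1) → ℤ) (κ' : Fin (d + 1)) (u : Fin (d + 1) → ℤ),
      ∑ μ, (colH K N μ (y - unitVec μ) κ' u - colH K N μ y κ' u) = cH * gaugeWt N y κ' u)
    (y : Fin (d + 1) → ℤ) :
    divV (e3OfK N K S) y = -(cH • mmRead N (comp (comp K (∑ v ∈ box (d + 1) N, divV S ((N : ℤ) • y + toSite v))) K)) := by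
  have hKex : ∃ δ C : ℝ, 0 < δ ∧ 0 ≤ C ∧ Decays K C δ := ⟨δ, C, hδ, hK.nonneg (Sum.inl 0), hK⟩
  set BV : ℝ := ((d + 1 : ℕ) : ℝ) * (C * ExpKernelCalculus.Zl (d + 1) δ * B)
  have hV : ∀ (μ : Fin (d + 1)) (w : Fin (d + 1) → ℤ), Bdd (vertexOfK K N S μ w) BV :=
    fun μ w x z a b => abs_vertexOfK_le hK hδ N hS μ w x z a b
  have hD : ∀ μ : Fin (d + 1), Bdd (vertexOfK K N S μ (y - unitVec μ) - vertexOfK K N S μ y) (BV + BV) := by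
    intro μ x z a b
    simp only [Pi.sub_apply]
    exact (abs_sub _ _).trans (add_le_add (hV μ _ x z a b) (hV μ y x z a b))
  -- the divergence of the family of sandwiches is minus the sandwich of the divergence of the vertices
  have e1 : divV (e3OfK N K S) y = -mmRead N (comp (comp K (divV (vertexOfK K N S) y)) K) := by
    have e0 : divV (vertexOfK K N S) y = ∑ μ, (vertexOfK K N S μ (y - unitVec μ) - vertexOfK K N S μ y) := rfl
    rw [e0, sandwich_finset_sum Finset.univ hK hδ N hD]
    simp only [KernelWard.divV, e3OfK_eq_neg_sandwich, ← Finset.sum_neg_distrib]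
    refine Finset.sum_congr rfl fun μ _ => ?_
    rw [sandwich_sub hK hδ N (hV μ (y - unitVec μ)) (hV μ y), neg_sub', sub_eq_add_neg]
  rw [e1, divV_vertexOfK_eq_smul_boxSum (N := N) hKex hN hS cH hH y, KernelReflection.comp_smul_right, KernelReflection.comp_smul_left,
    mmRead_smul]

end SSlot

/-! ## §3 The double source-slot divergence of the linear step -/

section Double

variable [NeZero N] {K : MKer (d + 1) (Fib d)} {C δ : ℝ}
  {T : Fin (d + 1) → (Fin (d + 1) → ℤ) → Fin (d + 1) → (Fin (d + 1) → ℤ) → MKer (d + 1) (Fib d)} {B : ℝ} {cH : ℝ}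

/-- [folklore] **T-EQ, BOTH SOURCE SLOTS** (symmetric table): for a decaying `K` (rate `δ > 0`), nonzero `N`, a bounded bi-table `T` with
`T κ u κ′ u′ = T κ′ u′ κ u`, any `c`, under (hH) with constant `c_H`: the divergence in the SECOND output bond of the first-bond pure-gauge slice of
`lin4 c K N T` at the coarse pair `(y, y′)` is
`−((c·c_H·c_H) • mmRead N (K ∘ (Σ_{v′ ∈ box} divV F_y (N•y′ + toSite v′)) ∘ K))`, `F_y κ u := Σ_{v ∈ box} divV (T κ u) (N•y + toSite v)` —
PART 1's `divW_lin4_of_symm` followed by §2 on the block-summed family `F_y` (bounded by PART 1's `abs_boxSum_divV_le`). -/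
theorem divV_divW_lin4_of_symm (hK : Decays K C δ) (hδ : 0 < δ) (c : ℝ) (hT : ∀ κ u κ' u' x z a b, |T κ u κ' u' x z a b| ≤ B)
    (hsym : ∀ κ u κ' u', T κ u κ' u' = T κ' u' κ u)
    (hH : ∀ (y : Fin (d + 1) → ℤ) (κ' : Fin (d + 1)) (u : Fin (d + 1) → ℤ),
      ∑ μ, (colH K N μ (y - unitVec μ) κ' u - colH K N μ y κ' u) = cH * gaugeWt N y κ' u)
    (y y' : Fin (d + 1) → ℤ) :
    divV (fun ν y' => divW (lin4 c K N T) y ν y') y'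
      = -((c * cH * cH) • mmRead N (comp (comp K
          (∑ v' ∈ box (d + 1) N, divV (fun κ u => ∑ v ∈ box (d + 1) N, divV (T κ u) ((N : ℤ) • y + toSite v)) ((N : ℤ) • y' + toSite v'))) K)) := by
  have hN : 1 ≤ N := one_le_of_neZero N
  -- PART 1: the first-bond slice, as a first-order family in the second bond, is `(c·c_H) •` the S-slot map of `F_y`
  have e1 : (fun ν y' => divW (lin4 c K N T) y ν y')
      = (c * cH) • e3OfK N K (fun κ u => ∑ v ∈ box (d + 1) N, divV (T κ u) ((N : ℤ) • y + toSite v)) := by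
    funext ν y'
    rw [divW_lin4_of_symm hK hδ c hT hsym hH y ν y', Pi.smul_apply, Pi.smul_apply]
  rw [e1, divV_smul_family, divV_e3OfK hK hδ hN (fun κ u x z a b => abs_boxSum_divV_le hT y κ u x z a b) hH y', smul_neg, smul_smul]

end Double

/-! ## §4 The comb ∕ wall instance -/

section Comb

variable {Lc : ℕ} [NeZero Lc] {r : Fin (d + 1) → ℕ}

/-- [folklore] **T-EQ FOR THE S-SLOT MAP OF THE NORMALISED CO-DRESSED STEP RESOLVENT** (every `j`, every in-block root, every bounded `S`):
`divV (e3OfK Lc K♮ᴱ_j S) y = −((Lc^{d+1})⁻¹ • mmRead Lc (K♮ᴱ_j ∘ (Σ_{v ∈ box} divV S (Lc•y + toSite v)) ∘ K♮ᴱ_j))`. -/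
theorem divV_e3OfK_comb (hr : r ∈ box (d + 1) Lc) (j : ℕ) {S : Fin (d + 1) → (Fin (d + 1) → ℤ) → MKer (d + 1) (Fib d)} {B : ℝ}
    (hS : ∀ κ u x z a b, |S κ u x z a b| ≤ B) (y : Fin (d + 1) → ℤ) :
    divV (e3OfK Lc (unitK (sfStep Lc j) (smStep d Lc j) (coDressKBmAt (toSite r) Lc (KInvStep (d := d) Lc j))) S) y
      = -(((Lc : ℝ) ^ (d + 1))⁻¹ • mmRead Lc
          (comp (comp (unitK (sfStep Lc j) (smStep d Lc j) (coDressKBmAt (toSite r) Lc (KInvStep (d := d) Lc j)))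
            (∑ v ∈ box (d + 1) Lc, divV S ((Lc : ℤ) • y + toSite v)))
            (unitK (sfStep Lc j) (smStep d Lc j) (coDressKBmAt (toSite r) Lc (KInvStep (d := d) Lc j))))) := by
  obtain ⟨δK, CK, hδK, -, hG⟩ := decays_coDressKBmAt_KInvStep (d := d) hr j
  exact divV_e3OfK (decays_unitK hG) hδK (one_le_of_neZero Lc) hS (hH_unitK_comb hr j) y

/-- [folklore] **T-EQ, BOTH SOURCE SLOTS, FOR THE DRESSED COMB STEP** (every `j`, every in-block root, every symmetric bounded `T`, any `c`):
`divV (ν y′ ↦ divW (lin4 c K♮ᴱ_j Lc T) y ν y′) y′ = −((c·(Lc^{d+1})⁻¹·(Lc^{d+1})⁻¹) • mmRead Lc (K♮ᴱ_j ∘ (Σ_{v′} divV F_y (Lc•y′ + toSite v′)) ∘ K♮ᴱ_j))`. -/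
theorem divV_divW_lin4_comb_of_symm (hr : r ∈ box (d + 1) Lc) (j : ℕ) (c : ℝ)
    {T : Fin (d + 1) → (Fin (d + 1) → ℤ) → Fin (d + 1) → (Fin (d + 1) → ℤ) → MKer (d + 1) (Fib d)} {B : ℝ}
    (hT : ∀ κ u κ' u' x z a b, |T κ u κ' u' x z a b| ≤ B) (hsym : ∀ κ u κ' u', T κ u κ' u' = T κ' u' κ u)
    (y y' : Fin (d + 1) → ℤ) :
    divV (fun ν y' => divW (lin4 c (unitK (sfStep Lc j) (smStep d Lc j) (coDressKBmAt (toSite r) Lc (KInvStep (d := d) Lc j))) Lc T) y ν y') y'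
      = -((c * ((Lc : ℝ) ^ (d + 1))⁻¹ * ((Lc : ℝ) ^ (d + 1))⁻¹) • mmRead Lc
          (comp (comp (unitK (sfStep Lc j) (smStep d Lc j) (coDressKBmAt (toSite r) Lc (KInvStep (d := d) Lc j)))
            (∑ v' ∈ box (d + 1) Lc, divV (fun κ u => ∑ v ∈ box (d + 1) Lc, divV (T κ u) ((Lc : ℤ) • y + toSite v))
              ((Lc : ℤ) • y' + toSite v')))
            (unitK (sfStep Lc j) (smStep d Lc j) (coDressKBmAt (toSite r) Lc (KInvStep (d := d) Lc j))))) := by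
  obtain ⟨δK, CK, hδK, -, hG⟩ := decays_coDressKBmAt_KInvStep (d := d) hr j
  exact divV_divW_lin4_of_symm (decays_unitK hG) hδK c hT hsym (hH_unitK_comb hr j) y y'

end Comb

end Summit.QuantumFields.BalabanUV.Beta.GAN24.E3SlotDivergence

end
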